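import Mathlib.Analysis.SumIntegralComparisons
import Mathlib.Analysis.SpecialFunctions.Gamma.Basic
import Mathlib.Analysis.SpecialFunctions.Pow.Asymptotics
import Mathlib.Analysis.SpecialFunctions.Pow.Deriv
import Mathlib.Analysis.SpecialFunctions.ImproperIntegrals
import Mathlib.Analysis.SpecialFunctions.Integrals.Basic
import Mathlib.MeasureTheory.Integral.ExpDecay
import Mathlib.MeasureTheory.Function.JacobianOneDim
import Mathlib.NumberTheory.Harmonic.Bounds
import Literature.NumberTheory.LFunctions.TauberianTheorems
import Literature.NumberTheory.LFunctions.Tauberian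
import Literature.NumberTheory.LFunctions.KaramataTauberian

/-!
# Proof of the Hardy–Littlewood Tauberian theorem for Dirichlet series (MV Thm. 5.11)

Topic `Literature/NumberTheory/LFunctions`. This file DISCHARGES the named fact
`Literature.NumberTheory.LFunctions.HardyLittlewoodTauberianDirichlet` (`TauberianTheorems.lean`; Montgomery–Vaughan,
*Multiplicative Number Theory I*, Thm. 5.11, p. 125) — `HardyLittlewoodTauberianDirichlet_holds` —
and, as a corollary, its little-`o` twin `Literature.NumberTheory.LFunctions.MontgomeryVaughan2007_5_11`
(`Tauberian.lean`) — `NumberTheory.MontgomeryVaughan2007_5_11_holds`. Everything is proved; no `sorry`.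

## The argument

The Karamata step is `Literature.NumberTheory.LFunctions.HardyLittlewoodTauberianSums_holds` (`KaramataTauberian.lean`: MV
Thm. 5.7 in Stieltjes form, case `α = 0`), applied with `λ_n = log n`. Writing `K = β + 1` and
`v_n = (K + log n)^{β-1}/n` (the function `phi K (β-1) 1` below; the shift `K` instead of MV's `1`
makes `t ↦ (K + log t)^γ t^{-s}` antitone on `[1, ∞)` for `γ ≤ K ≤ s·K`, so the integral test
applies without an initial segment), the reduction (MV p. 125, cases `α ≠ 0`) is: put
`c_n = a_n/n − m_n` with the main term `m_n = (α/Γ(β)) v_n` (`β > 0`) resp. `m_n = α·[n = 1]`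
(`β = 0`); then `c_n ≥ −W v_n` by the Tauberian hypothesis
(`(1 + log n)^{β-1} ≤ K (K+log n)^{β-1}`),
`δ^β Σ c_n n^{-δ} → α − α = 0`, and `Σ_{n ≤ N} c_n = o((log N)^β)` gives the theorem once
`Σ_{n ≤ N} m_n ∼ (α/Γ(β+1)) (log N)^β`. The analytic inputs, all for `φ(t) = (K + log t)^γ t^{-s}`:

* `phi_antitoneOn`, `phi_subst` (substitution `t = e^{v−K}`:
  `∫_1^∞ φ = e^{(s−1)K} ∫_K^∞ v^γ e^{−(s−1)v} dv`, via
  `MeasureTheory.integral_image_eq_integral_abs_deriv_smul`), `phi_summable`, `phi_tsum_bounds`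
  (integral test, Mathlib `AntitoneOn.summable_of_integrableOn_Ioi` & co.);
* (E3) `tendsto_rpow_mul_tsum_phi`: `δ^β Σ_{n≥1} (K+log n)^{β−1} n^{−1−δ} → Γ(β)` (MV p. 125:
  `∫_0^∞ v^{β−1} e^{−δv} dv = δ^{−β} Γ(β)`, `Real.integral_rpow_mul_exp_neg_mul_Ioi`);
* (E4) `tendsto_sum_phi_div`: `Σ_{n≤N} (K+log n)^{β−1}/n ∼ (log N)^β/β` (FTC + integral test);
* (E1) `tsum_phi_mul_x_le`: `Σ v_n x_n(1−x_n) ≪ U^β`, `x_n = n^{−1/U}` (MV p. 124, "the first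
  integral is `≪ U^β`": split at `log n = U`, harmonic bound below, `Σ n^{−1−1/(2U)} ≤ 1 + 2U`
  above);
* (E2) `tsum_window_le`: `Σ_{(1−ε)U ≤ log n ≤ (1+ε)U} v_n ≪ ε U^β` (MV p. 124, "the second
  integral is `≪ εU^β`": harmonic numbers, `harmonic_floor_le_one_add_log`,
  `log_le_harmonic_floor`).

## References

* H. L. Montgomery, R. C. Vaughan, *Multiplicative Number Theory I. Classical Theory*, Cambridge
  Stud. Adv. Math. 97, CUP 2007, §5.2, Thm. 5.7 (pp. 123–125), Thm. 5.11 (pp. 125–126).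
  [cite: MontgomeryVaughan2007]
-/

noncomputable section

open Filter Set MeasureTheory
open scoped Topology

namespace Literature.NumberTheory.LFunctions

namespace Karamata

/-- `φ_{K,γ,s}(t) = (K + log t)^γ · t^{-s}` (`t ≥ 1`): the common shape of the weights
`(K + log n)^{β-1}/n^{1+δ}` and main terms in the proof of MV Thm. 5.11. [folklore] -/
def phi (K γ s : ℝ) (t : ℝ) : ℝ := (K + Real.log t) ^ γ * t ^ (-s)

/-- `φ(0) = 0` (junk value of `0 ^ (-s)`, `s ≠ 0`); makes `n = 0` terms vanish. [folklore] -/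
lemma phi_zero (K γ : ℝ) {s : ℝ} (hs : s ≠ 0) : phi K γ s 0 = 0 := by
  simp [phi, Real.zero_rpow (neg_ne_zero.mpr hs)]

/-- `φ(1) = K^γ`. [folklore] -/
lemma phi_one (K γ s : ℝ) : phi K γ s 1 = K ^ γ := by simp [phi]

/-- `φ ≥ 0` on `[1, ∞)`. [folklore] -/
lemma phi_nonneg {K : ℝ} (hK : 0 < K) (γ s : ℝ) {t : ℝ} (ht : 1 ≤ t) : 0 ≤ phi K γ s t := by
  have := Real.log_nonneg ht
  exact mul_nonneg (Real.rpow_nonneg (by linarith) _) (Real.rpow_nonneg (by linarith) _)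

/-- `φ` is antitone on `[1, ∞)` when `γ ≤ K`, `1 ≤ s`. [folklore] -/
lemma phi_antitoneOn {K γ s : ℝ} (hK : 0 < K) (hγ : γ ≤ K) (hs : 1 ≤ s) :
    AntitoneOn (phi K γ s) (Ici 1) := by
  intro t₁ ht₁ t₂ ht₂ h12
  simp only [phi, mem_Ici] at *
  have ht₁0 : 0 < t₁ := by linarith
  have ht₂0 : 0 < t₂ := by linarith
  have hu₁ : 0 ≤ Real.log t₁ := Real.log_nonneg ht₁
  have hu12 : Real.log t₁ ≤ Real.log t₂ := Real.log_le_log ht₁0 h12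
  set u₁ := Real.log t₁
  set u₂ := Real.log t₂
  rw [Real.rpow_def_of_pos ht₁0, Real.rpow_def_of_pos ht₂0]
  have hK1 : 0 < K + u₁ := by linarith
  have hK2 : 0 < K + u₂ := by linarith
  have key : (K + u₂) ^ γ ≤ (K + u₁) ^ γ * Real.exp (u₂ - u₁) := by
    rcases le_or_gt γ 0 with hγ0 | hγ0
    · have h1 : (K + u₂) ^ γ ≤ (K + u₁) ^ γ := Real.rpow_le_rpow_of_nonpos hK1 (by linarith) hγ0
      have h2 : 1 ≤ Real.exp (u₂ - u₁) := Real.one_le_exp_iff.mpr (by linarith)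
      have h3 : 0 ≤ (K + u₁) ^ γ := Real.rpow_nonneg hK1.le _
      nlinarith
    · have hratio : (K + u₂) / (K + u₁) ≤ Real.exp ((u₂ - u₁) / K) := by
        have : (K + u₂) / (K + u₁) = 1 + (u₂ - u₁) / (K + u₁) := by field_simp; ring
        rw [this]
        have h3 : (u₂ - u₁) / (K + u₁) ≤ (u₂ - u₁) / K :=
          div_le_div_of_nonneg_left (by linarith) hK (by linarith)
        linarith [Real.add_one_le_exp ((u₂ - u₁) / K)]
      have h4 : ((K + u₂) / (K + u₁)) ^ γ ≤ Real.exp ((u₂ - u₁) / K) ^ γ :=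
        Real.rpow_le_rpow (by positivity) hratio hγ0.le
      rw [Real.div_rpow hK2.le hK1.le, div_le_iff₀ (Real.rpow_pos_of_pos hK1 _),
        ← Real.exp_mul] at h4
      refine h4.trans ?_
      rw [mul_comm]
      gcongr
      rw [div_mul_eq_mul_div, div_le_iff₀ hK]
      nlinarith
  calc (K + u₂) ^ γ * Real.exp (u₂ * -s)
      ≤ (K + u₁) ^ γ * Real.exp (u₂ - u₁) * Real.exp (u₂ * -s) := by gcongr
    _ = (K + u₁) ^ γ * Real.exp (u₂ - u₁ + u₂ * -s) := by rw [mul_assoc, ← Real.exp_add]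
    _ ≤ (K + u₁) ^ γ * Real.exp (u₁ * -s) := by gcongr ?_ * Real.exp ?_; nlinarith

/-- `φ` is continuous on `[1, ∞)`. [folklore] -/
lemma phi_continuousOn {K : ℝ} (hK : 0 < K) (γ s : ℝ) : ContinuousOn (phi K γ s) (Ici 1) := by
  intro t ht
  have ht0 : 0 < t := lt_of_lt_of_le one_pos ht
  have hpos : K + Real.log t ≠ 0 := by have := Real.log_nonneg ht; linarith
  refine ContinuousAt.continuousWithinAt ?_
  unfold phi
  exact ((continuousAt_const.add (Real.continuousAt_log ht0.ne')).rpow_const (Or.inl hpos)).mul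
    (Real.continuousAt_rpow_const _ _ (Or.inl ht0.ne'))

/-- `v ↦ e^{v-K}` maps `(K, ∞)` onto `(1, ∞)`. [folklore] -/
lemma image_exp_sub_Ioi (K : ℝ) : (fun v => Real.exp (v - K)) '' Ioi K = Ioi 1 := by
  rw [show (fun v => Real.exp (v - K)) = Real.exp ∘ (fun v => v - K) from rfl, Set.image_comp,
    Set.image_sub_const_Ioi, sub_self, Real.image_exp_Ioi, Real.exp_zero]

/-- Substitution `t = e^{v-K}` in `∫_1^∞ φ`: integrability transfers and
`∫_{1}^∞ (K + log t)^γ t^{-s} dt = e^{(s-1)K} ∫_K^∞ v^γ e^{-(s-1)v} dv`. [folklore] -/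
lemma phi_subst (K γ s : ℝ) :
    (IntegrableOn (phi K γ s) (Ioi 1) ↔ IntegrableOn
      (fun v => Real.exp ((s - 1) * K) * (v ^ γ * Real.exp (-((s - 1) * v)))) (Ioi K)) ∧
    ∫ t in Ioi 1, phi K γ s t =
      ∫ v in Ioi K, Real.exp ((s - 1) * K) * (v ^ γ * Real.exp (-((s - 1) * v))) := by
  have hderiv : ∀ v ∈ Ioi K,
      HasDerivWithinAt (fun v => Real.exp (v - K)) (Real.exp (v - K)) (Ioi K) v := by
    intro v _
    have := ((hasDerivAt_id v).sub_const K).exp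
    simpa using this.hasDerivWithinAt
  have hinj : InjOn (fun v => Real.exp (v - K)) (Ioi K) :=
    fun a _ b _ h => by simpa using Real.exp_injective h
  have hpt : ∀ v ∈ Ioi K, |Real.exp (v - K)| • phi K γ s (Real.exp (v - K)) =
      Real.exp ((s - 1) * K) * (v ^ γ * Real.exp (-((s - 1) * v))) := by
    intro v _
    rw [abs_of_pos (Real.exp_pos _), smul_eq_mul, phi, Real.log_exp,
      Real.rpow_def_of_pos (Real.exp_pos _), Real.log_exp, show K + (v - K) = v by ring]
    have : Real.exp (v - K) * Real.exp ((v - K) * -s) =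
        Real.exp ((s - 1) * K) * Real.exp (-((s - 1) * v)) := by
      rw [← Real.exp_add, ← Real.exp_add]; congr 1; ring
    calc Real.exp (v - K) * (v ^ γ * Real.exp ((v - K) * -s))
        = v ^ γ * (Real.exp (v - K) * Real.exp ((v - K) * -s)) := by ring
      _ = _ := by rw [this]; ring
  constructor
  · rw [← image_exp_sub_Ioi K,
      integrableOn_image_iff_integrableOn_abs_deriv_smul measurableSet_Ioi hderiv hinj]
    exact integrableOn_congr_fun hpt measurableSet_Ioi
  · rw [← image_exp_sub_Ioi K,
      integral_image_eq_integral_abs_deriv_smul measurableSet_Ioi hderiv hinj]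
    exact setIntegral_congr_fun measurableSet_Ioi hpt

/-- `v^γ e^{-δv}` is integrable on `(K, ∞)` for `K > 0`, `δ > 0` (any real `γ`). [folklore] -/
lemma integrableOn_rpow_mul_exp {K δ : ℝ} (hK : 0 < K) (hδ : 0 < δ) (γ : ℝ) :
    IntegrableOn (fun v => v ^ γ * Real.exp (-(δ * v))) (Ioi K) := by
  refine integrable_of_isBigO_exp_neg (half_pos hδ) ?_ ?_
  · intro v hv
    have hv0 : 0 < v := lt_of_lt_of_le hK hv
    exact ((Real.continuousAt_rpow_const v γ (Or.inl hv0.ne')).mul (by fun_prop)).continuousWithinAt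
  · refine Asymptotics.IsLittleO.isBigO ?_
    refine Asymptotics.isLittleO_of_tendsto' ?_ ?_
    · filter_upwards with v h using absurd h (Real.exp_pos _).ne'
    · have := tendsto_rpow_mul_exp_neg_mul_atTop_nhds_zero γ (δ / 2) (half_pos hδ)
      refine this.congr' ?_
      filter_upwards with v
      rw [mul_div_assoc, ← Real.exp_sub]
      congr 2; ring

/-- `φ` is integrable on `(1, ∞)` for `s > 1`. [folklore] -/
lemma phi_integrableOn {K γ s : ℝ} (hK : 0 < K) (hs : 1 < s) : IntegrableOn (phi K γ s) (Ioi 1) :=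
  (phi_subst K γ s).1.mpr ((integrableOn_rpow_mul_exp hK (by linarith) γ).const_mul _)

/-- `Σ_n φ(n)` converges for `γ ≤ K`, `s > 1` (integral test). [folklore] -/
lemma phi_summable {K γ s : ℝ} (hK : 0 < K) (hγ : γ ≤ K) (hs : 1 < s) :
    Summable (fun n : ℕ => phi K γ s n) :=
  AntitoneOn.summable_of_integrableOn_Ioi (N := 1) (by exact_mod_cast phi_antitoneOn hK hγ hs.le)
    (by exact_mod_cast phi_integrableOn (γ := γ) hK hs)
    (by exact_mod_cast fun t ht => phi_nonneg hK γ s (le_of_lt ht))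

/-- Integral test, both directions: `∫_1^∞ φ ≤ Σ_{n ≥ 1} φ(n) ≤ φ(1) + ∫_1^∞ φ`. [folklore] -/
lemma phi_tsum_bounds {K γ s : ℝ} (hK : 0 < K) (hγ : γ ≤ K) (hs : 1 < s) :
    ∫ t in Ioi 1, phi K γ s t ≤ ∑' n : ℕ, phi K γ s n ∧
      ∑' n : ℕ, phi K γ s n ≤ K ^ γ + ∫ t in Ioi 1, phi K γ s t := by
  have hsum := phi_summable hK hγ hs
  have hanti : AntitoneOn (phi K γ s) (Ici ((1 : ℕ) : ℝ)) := by
    exact_mod_cast phi_antitoneOn hK hγ hs.le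
  have hint : IntegrableOn (phi K γ s) (Ioi ((1 : ℕ) : ℝ)) := by
    exact_mod_cast phi_integrableOn (γ := γ) hK hs
  have hnn : ∀ t ∈ Ioi ((1 : ℕ) : ℝ), 0 ≤ phi K γ s t := by
    exact_mod_cast fun t ht => phi_nonneg hK γ s (le_of_lt ht)
  have h0 : ∑' n : ℕ, phi K γ s n = ∑' n : ℕ, phi K γ s (n + 1 : ℕ) := by
    rw [hsum.tsum_eq_zero_add]
    simp [phi_zero K γ (show s ≠ 0 by linarith)]
  have hsum1 : Summable fun n : ℕ => phi K γ s (n + 1 : ℕ) := (summable_nat_add_iff 1).mpr hsum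
  constructor
  · rw [h0]
    exact_mod_cast hanti.integral_le_tsum_comp_add 1 hsum hnn
  · rw [h0, hsum1.tsum_eq_zero_add]
    have := hanti.tsum_comp_add_le_integral 1 hint hnn
    push_cast at this ⊢
    simp only [phi_one]
    linarith

/-- `δ^β ∫_K^∞ v^{β-1} e^{-δv} dv → Γ(β)` as `δ → 0⁺` (`β > 0`, `K > 0`). [folklore] -/
lemma tendsto_rpow_mul_integral_Ioi {K β : ℝ} (hK : 0 < K) (hβ : 0 < β) :
    Tendsto (fun δ : ℝ => δ ^ β * ∫ v in Ioi K, v ^ (β - 1) * Real.exp (-(δ * v)))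
      (𝓝[>] 0) (𝓝 (Real.Gamma β)) := by
  set R : ℝ → ℝ := fun δ => ∫ v in Ioc 0 K, v ^ (β - 1) * Real.exp (-(δ * v)) with hR
  have hIoc : IntegrableOn (fun v : ℝ => v ^ (β - 1)) (Ioc 0 K) :=
    (intervalIntegrable_iff_integrableOn_Ioc_of_le hK.le).mp
      (intervalIntegral.intervalIntegrable_rpow' (by linarith))
  set M : ℝ := ∫ v in Ioc 0 K, v ^ (β - 1) with hM
  have hRb : ∀ δ : ℝ, 0 < δ → 0 ≤ R δ ∧ R δ ≤ M := by
    intro δ hδ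
    have hle : ∀ v ∈ Ioc (0 : ℝ) K, v ^ (β - 1) * Real.exp (-(δ * v)) ≤ v ^ (β - 1) := by
      intro v hv
      have : Real.exp (-(δ * v)) ≤ 1 := Real.exp_le_one_iff.mpr (by nlinarith [hv.1])
      exact mul_le_of_le_one_right (Real.rpow_nonneg hv.1.le _) this
    have hnn : ∀ v ∈ Ioc (0 : ℝ) K, 0 ≤ v ^ (β - 1) * Real.exp (-(δ * v)) :=
      fun v hv => mul_nonneg (Real.rpow_nonneg hv.1.le _) (Real.exp_pos _).le
    have hintR : IntegrableOn (fun v : ℝ => v ^ (β - 1) * Real.exp (-(δ * v))) (Ioc 0 K) := by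
      refine Integrable.mono' hIoc ?_ ?_
      · exact ((measurable_id.pow_const _).mul (by fun_prop)).aestronglyMeasurable
      · filter_upwards [ae_restrict_mem measurableSet_Ioc] with v hv
        rw [Real.norm_eq_abs, abs_of_nonneg (hnn v hv)]
        exact hle v hv
    exact ⟨setIntegral_nonneg measurableSet_Ioc hnn,
      setIntegral_mono_on hintR hIoc measurableSet_Ioc hle⟩
  have key : ∀ δ : ℝ, 0 < δ →
      δ ^ β * ∫ v in Ioi K, v ^ (β - 1) * Real.exp (-(δ * v)) = Real.Gamma β - δ ^ β * R δ := by
    intro δ hδ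
    have hval := Real.integral_rpow_mul_exp_neg_mul_Ioi hβ hδ
    have hint : IntegrableOn (fun v : ℝ => v ^ (β - 1) * Real.exp (-(δ * v))) (Ioi 0) :=
      .of_integral_ne_zero (by rw [hval]; positivity)
    have hsplit : ∫ v in Ioi 0, v ^ (β - 1) * Real.exp (-(δ * v)) =
        R δ + ∫ v in Ioi K, v ^ (β - 1) * Real.exp (-(δ * v)) := by
      rw [← Ioc_union_Ioi_eq_Ioi hK.le, setIntegral_union (Ioc_disjoint_Ioi le_rfl)
        measurableSet_Ioi (hint.mono_set Ioc_subset_Ioi_self)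
        (hint.mono_set (Ioi_subset_Ioi hK.le))]
    rw [hval] at hsplit
    have : ∫ v in Ioi K, v ^ (β - 1) * Real.exp (-(δ * v)) = (1 / δ) ^ β * Real.Gamma β - R δ := by
      linarith
    rw [this, mul_sub, ← mul_assoc, ← Real.mul_rpow hδ.le (by positivity),
      mul_one_div_cancel hδ.ne', Real.one_rpow, one_mul]
  have hδβ : Tendsto (fun δ : ℝ => δ ^ β) (𝓝[>] 0) (𝓝 0) := by
    have := (Real.continuousAt_rpow_const 0 β (Or.inr hβ.le)).tendsto
    rw [Real.zero_rpow hβ.ne'] at this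
    exact this.mono_left nhdsWithin_le_nhds
  have hsq : Tendsto (fun δ : ℝ => δ ^ β * R δ) (𝓝[>] 0) (𝓝 0) := by
    refine tendsto_of_tendsto_of_tendsto_of_le_of_le' tendsto_const_nhds
      (by simpa using hδβ.mul_const M) ?_ ?_
    · filter_upwards [self_mem_nhdsWithin] with δ hδ
      exact mul_nonneg (Real.rpow_nonneg (le_of_lt hδ) _) (hRb δ hδ).1
    · filter_upwards [self_mem_nhdsWithin] with δ hδ
      exact mul_le_mul_of_nonneg_left (hRb δ hδ).2 (Real.rpow_nonneg (le_of_lt hδ) _)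
  have : Tendsto (fun δ : ℝ => Real.Gamma β - δ ^ β * R δ) (𝓝[>] 0) (𝓝 (Real.Gamma β)) := by
    simpa using hsq.const_sub (Real.Gamma β)
  refine this.congr' ?_
  filter_upwards [self_mem_nhdsWithin] with δ hδ
  exact (key δ hδ).symm

/-- (E3) `δ^β Σ_{n ≥ 1} (K + log n)^{β-1} n^{-1-δ} → Γ(β)` as `δ → 0⁺` (`0 < β`, `β - 1 ≤ K`).
[cite: MontgomeryVaughan2007, Thm. 5.7 (proof, p. 125)] -/
lemma tendsto_rpow_mul_tsum_phi {K β : ℝ} (hK : 0 < K) (hβ : 0 < β) (hβK : β - 1 ≤ K) :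
    Tendsto (fun δ : ℝ => δ ^ β * ∑' n : ℕ, phi K (β - 1) (1 + δ) n) (𝓝[>] 0)
      (𝓝 (Real.Gamma β)) := by
  -- the integral, after substitution
  have hI : ∀ δ : ℝ, 0 < δ → ∫ t in Ioi 1, phi K (β - 1) (1 + δ) t =
      Real.exp (δ * K) * ∫ v in Ioi K, v ^ (β - 1) * Real.exp (-(δ * v)) := by
    intro δ hδ
    rw [(phi_subst K (β - 1) (1 + δ)).2, integral_const_mul]
    simp only [add_sub_cancel_left]
  have hlim1 : Tendsto (fun δ : ℝ => δ ^ β * ∫ t in Ioi 1, phi K (β - 1) (1 + δ) t) (𝓝[>] 0)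
      (𝓝 (Real.Gamma β)) := by
    have he : Tendsto (fun δ : ℝ => Real.exp (δ * K)) (𝓝[>] 0) (𝓝 1) := by
      have : Tendsto (fun δ : ℝ => Real.exp (δ * K)) (𝓝 0) (𝓝 (Real.exp (0 * K))) :=
        (Real.continuous_exp.tendsto _).comp ((continuous_id.mul continuous_const).tendsto 0)
      rw [zero_mul, Real.exp_zero] at this
      exact this.mono_left nhdsWithin_le_nhds
    have := he.mul (tendsto_rpow_mul_integral_Ioi hK hβ)
    rw [one_mul] at this
    refine this.congr' ?_
    filter_upwards [self_mem_nhdsWithin] with δ hδ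
    rw [hI δ hδ]; ring
  have hlim2 : Tendsto (fun δ : ℝ => δ ^ β * K ^ (β - 1) +
      δ ^ β * ∫ t in Ioi 1, phi K (β - 1) (1 + δ) t) (𝓝[>] 0) (𝓝 (Real.Gamma β)) := by
    have hδβ : Tendsto (fun δ : ℝ => δ ^ β) (𝓝[>] 0) (𝓝 0) := by
      have := (Real.continuousAt_rpow_const 0 β (Or.inr hβ.le)).tendsto
      rw [Real.zero_rpow hβ.ne'] at this
      exact this.mono_left nhdsWithin_le_nhds
    simpa using (hδβ.mul_const (K ^ (β - 1))).add hlim1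
  refine tendsto_of_tendsto_of_tendsto_of_le_of_le' hlim1 hlim2 ?_ ?_
  · filter_upwards [self_mem_nhdsWithin] with δ hδ
    have := (phi_tsum_bounds hK hβK (lt_add_of_pos_right 1 hδ)).1
    exact mul_le_mul_of_nonneg_left this (Real.rpow_nonneg (le_of_lt hδ) _)
  · filter_upwards [self_mem_nhdsWithin] with δ hδ
    have := (phi_tsum_bounds hK hβK (lt_add_of_pos_right 1 hδ)).2
    have h0 : 0 ≤ δ ^ β := Real.rpow_nonneg (le_of_lt hδ) _
    nlinarith


/-! ### (E4) partial sums of the main term -/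

/-- `∫_1^N (K + log t)^{β-1}/t dt = ((K + log N)^β - K^β)/β`. [folklore] -/
lemma integral_phi_one {K β : ℝ} (hK : 0 < K) (hβ : 0 < β) {N : ℝ} (hN : 1 ≤ N) :
    ∫ t in (1 : ℝ)..N, phi K (β - 1) 1 t = ((K + Real.log N) ^ β - K ^ β) / β := by
  have hderiv : ∀ t ∈ uIcc (1 : ℝ) N,
      HasDerivAt (fun t => (K + Real.log t) ^ β / β) (phi K (β - 1) 1 t) t := by
    intro t ht
    rw [uIcc_of_le hN] at ht
    have ht0 : 0 < t := by linarith [ht.1]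
    have hpos : K + Real.log t ≠ 0 := by have := Real.log_nonneg ht.1; linarith
    have h1 : HasDerivAt (fun t => K + Real.log t) t⁻¹ t := by
      simpa using (Real.hasDerivAt_log ht0.ne').const_add K
    have h2 := (h1.rpow_const (p := β) (Or.inl hpos)).div_const β
    refine h2.congr_deriv ?_
    unfold phi
    rw [Real.rpow_neg_one]
    field_simp
  rw [intervalIntegral.integral_eq_sub_of_hasDerivAt hderiv
    (((phi_continuousOn hK (β - 1) 1).mono (by rw [uIcc_of_le hN]; exact Icc_subset_Ici_self))
      |>.intervalIntegrable)]
  simp only [Real.log_one, add_zero]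
  ring

/-- Two-sided bound `((K+log N)^β - K^β)/β ≤ Σ_{n=1}^N (K+log n)^{β-1}/n ≤ K^{β-1} + same`.
[folklore] -/
lemma sum_phi_bounds {K β : ℝ} (hK : 0 < K) (hβ : 0 < β) (hβK : β - 1 ≤ K) {N : ℕ} (hN : 1 ≤ N) :
    ((K + Real.log N) ^ β - K ^ β) / β ≤ ∑ n ∈ Finset.Icc 1 N, phi K (β - 1) 1 n ∧
      ∑ n ∈ Finset.Icc 1 N, phi K (β - 1) 1 n ≤
        K ^ (β - 1) + ((K + Real.log N) ^ β - K ^ β) / β := by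
  have hI := integral_phi_one hK hβ (show (1 : ℝ) ≤ N by exact_mod_cast hN)
  have hanti : AntitoneOn (phi K (β - 1) 1) (Icc ((1 : ℕ) : ℝ) N) := by
    simpa using (phi_antitoneOn hK hβK le_rfl).mono (Icc_subset_Ici_self)
  have h1 := hanti.integral_le_sum_Ico hN
  have h2 := hanti.sum_le_integral_Ico hN
  push_cast at h1 h2
  rw [hI] at h1 h2
  have hIcc : Finset.Icc 1 N = Finset.Ico 1 (N + 1) := (Finset.Ico_add_one_right_eq_Icc 1 N).symm
  constructor
  · rw [hIcc, Finset.sum_Ico_succ_top hN]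
    have : 0 ≤ phi K (β - 1) 1 N := phi_nonneg hK _ _ (by exact_mod_cast hN)
    linarith
  · rw [hIcc, Finset.sum_eq_sum_Ico_succ_bot (by omega), ← Finset.sum_Ico_add' _ 1 N 1]
    push_cast
    rw [phi_one]
    linarith

/-- (E4) `Σ_{n=1}^N (K + log n)^{β-1}/n ∼ (log N)^β/β`. [folklore] -/
lemma tendsto_sum_phi_div {K β : ℝ} (hK : 0 < K) (hβ : 0 < β) (hβK : β - 1 ≤ K) :
    Tendsto (fun N : ℕ => (∑ n ∈ Finset.Icc 1 N, phi K (β - 1) 1 n) / Real.log N ^ β)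
      atTop (𝓝 (1 / β)) := by
  have hlog : Tendsto (fun N : ℕ => Real.log N) atTop atTop :=
    Real.tendsto_log_atTop.comp tendsto_natCast_atTop_atTop
  have hlogβ : Tendsto (fun N : ℕ => Real.log N ^ β) atTop atTop :=
    (tendsto_rpow_atTop hβ).comp hlog
  -- ((K + log N)/log N)^β → 1
  have hratio : Tendsto (fun N : ℕ => ((K + Real.log N) / Real.log N) ^ β) atTop (𝓝 1) := by
    have h1 : Tendsto (fun N : ℕ => (K + Real.log N) / Real.log N) atTop (𝓝 1) := by
      have : Tendsto (fun N : ℕ => K / Real.log N + 1) atTop (𝓝 (0 + 1)) :=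
        (tendsto_const_nhds.div_atTop hlog).add tendsto_const_nhds
      rw [zero_add] at this
      refine this.congr' ?_
      filter_upwards [hlog.eventually_gt_atTop 0] with N hN
      field_simp
    have := ((Real.continuousAt_rpow_const 1 β (Or.inl one_ne_zero)).tendsto).comp h1
    rw [Real.one_rpow] at this
    exact this
  have hmain : Tendsto (fun N : ℕ => ((K + Real.log N) ^ β - K ^ β) / β / Real.log N ^ β)
      atTop (𝓝 (1 / β)) := by
    have : Tendsto (fun N : ℕ => (1 / β) * (((K + Real.log N) / Real.log N) ^ β -
        K ^ β / Real.log N ^ β)) atTop (𝓝 ((1 / β) * (1 - 0))) :=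
      (hratio.sub (tendsto_const_nhds.div_atTop hlogβ)).const_mul _
    rw [sub_zero, mul_one] at this
    refine this.congr' ?_
    filter_upwards [hlog.eventually_gt_atTop 0] with N hN
    rw [Real.div_rpow (by linarith) hN.le]
    have : Real.log N ^ β ≠ 0 := (Real.rpow_pos_of_pos hN β).ne'
    field_simp
  have hupper : Tendsto (fun N : ℕ => K ^ (β - 1) / Real.log N ^ β +
      ((K + Real.log N) ^ β - K ^ β) / β / Real.log N ^ β) atTop (𝓝 (1 / β)) := by
    simpa using (tendsto_const_nhds.div_atTop hlogβ).add hmain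
  refine tendsto_of_tendsto_of_tendsto_of_le_of_le' hmain hupper ?_ ?_
  · filter_upwards [hlog.eventually_gt_atTop 0, eventually_ge_atTop 1] with N hN hN1
    exact div_le_div_of_nonneg_right (sum_phi_bounds hK hβ hβK hN1).1 (Real.rpow_nonneg hN.le _)
  · filter_upwards [hlog.eventually_gt_atTop 0, eventually_ge_atTop 1] with N hN hN1
    rw [← add_div]
    exact div_le_div_of_nonneg_right (sum_phi_bounds hK hβ hβK hN1).2 (Real.rpow_nonneg hN.le _)

/-! ### Harmonic sums over a range -/

/-- `Σ_{M < n ≤ N} 1/n = H_N - H_M`. [folklore] -/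
lemma sum_Ioc_inv_eq (M N : ℕ) (h : M ≤ N) :
    ∑ n ∈ Finset.Ioc M N, ((n : ℝ))⁻¹ = (harmonic N : ℝ) - harmonic M := by
  induction N, h using Nat.le_induction with
  | base => simp
  | succ N hMN ih =>
    rw [Finset.sum_Ioc_succ_top (by omega), ih, harmonic_succ]; push_cast; ring

/-- `Σ_{e^{a-1} < n ≤ e^b} 1/n ≤ 2 + b - a` for `1 ≤ a ≤ b`. [folklore] -/
lemma sum_Ioc_inv_le {a b : ℝ} (ha : 1 ≤ a) (hab : a ≤ b) :
    ∑ n ∈ Finset.Ioc ⌊Real.exp (a - 1)⌋₊ ⌊Real.exp b⌋₊, ((n : ℝ))⁻¹ ≤ 2 + b - a := by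
  rcases le_or_gt ⌊Real.exp (a - 1)⌋₊ ⌊Real.exp b⌋₊ with h | h
  · rw [sum_Ioc_inv_eq _ _ h]
    have h1 := harmonic_floor_le_one_add_log (Real.exp b) (Real.one_le_exp_iff.mpr (by linarith))
    have h2 := log_le_harmonic_floor (Real.exp (a - 1)) (Real.exp_pos _).le
    rw [Real.log_exp] at h1 h2
    linarith
  · rw [Finset.Ioc_eq_empty (by omega), Finset.sum_empty]
    linarith

/-! ### (E2) the weight on the window `(1 ± ε)U` -/

/-- On the window: `(K + log n)^{β-1} ≤ 3^{|β-1|} U^{β-1}` when `U ≥ K ≥ 1`, `ε < 1/4`.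
[folklore] -/
lemma rpow_window_le {K β ε U u : ℝ} (hK1 : 1 ≤ K) (hKU : K ≤ U) (hε : 0 < ε) (hε4 : ε < 1 / 4)
    (hu1 : (1 - ε) * U ≤ u) (hu2 : u ≤ (1 + ε) * U) :
    (K + u) ^ (β - 1) ≤ (3 : ℝ) ^ |β - 1| * U ^ (β - 1) := by
  have hU : 0 < U := by linarith
  rcases le_or_gt 1 β with hβ | hβ
  · rw [abs_of_nonneg (by linarith), ← Real.mul_rpow (by norm_num) hU.le]
    exact Real.rpow_le_rpow (by nlinarith) (by nlinarith) (by linarith)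
  · rw [abs_of_neg (by linarith), Real.rpow_neg (by norm_num : (0 : ℝ) ≤ 3),
      ← Real.inv_rpow (by norm_num : (0 : ℝ) ≤ 3), ← Real.mul_rpow (by norm_num) hU.le]
    exact Real.rpow_le_rpow_of_nonpos (by positivity) (by nlinarith) (by linarith)

/-- (E2) `Σ_{(1-ε)U ≤ log n ≤ (1+ε)U} (K + log n)^{β-1}/n ≤ 4·3^{|β-1|} ε U^β` eventually.
[cite: MontgomeryVaughan2007, Thm. 5.7 (proof, p. 124)] -/
lemma tsum_window_le {K β : ℝ} (hK1 : 1 ≤ K) {ε : ℝ} (hε : 0 < ε) (hε4 : ε < 1 / 4) :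
    ∀ᶠ U : ℝ in atTop, ∑' n : ℕ, (if (1 - ε) * U ≤ Real.log n ∧ Real.log n ≤ (1 + ε) * U
      then phi K (β - 1) 1 n else 0) ≤ (4 * (3 : ℝ) ^ |β - 1|) * ε * U ^ β := by
  filter_upwards [eventually_ge_atTop K, eventually_ge_atTop (2 : ℝ), eventually_ge_atTop ε⁻¹]
    with U hKU hU2 hUε
  have hU : 0 < U := by linarith
  set a := (1 - ε) * U with ha
  set b := (1 + ε) * U with hb
  have ha1 : 1 ≤ a := by rw [ha]; nlinarith
  have hab : a ≤ b := by rw [ha, hb]; nlinarith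
  set D := (3 : ℝ) ^ |β - 1| * U ^ (β - 1) with hD
  have hD0 : 0 ≤ D := by positivity
  set M := ⌊Real.exp (a - 1)⌋₊
  set N := ⌊Real.exp b⌋₊
  set g : ℕ → ℝ := fun n => if n ∈ Finset.Ioc M N then D * ((n : ℝ))⁻¹ else 0 with hg
  have hle : ∀ n : ℕ, (if (1 - ε) * U ≤ Real.log n ∧ Real.log n ≤ (1 + ε) * U
      then phi K (β - 1) 1 n else 0) ≤ g n := by
    intro n
    split_ifs with h
    · have hn0 : n ≠ 0 := by
        rintro rfl
        simp only [Nat.cast_zero, Real.log_zero] at h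
        linarith [h.1]
      have hn : (0 : ℝ) < n := by positivity
      have hmem : n ∈ Finset.Ioc M N := by
        rw [Finset.mem_Ioc]
        constructor
        · refine (Nat.floor_lt (Real.exp_pos _).le).mpr ?_
          calc Real.exp (a - 1) < Real.exp a := Real.exp_lt_exp.mpr (by linarith)
            _ ≤ n := (Real.le_log_iff_exp_le hn).mp h.1
        · exact Nat.le_floor ((Real.log_le_iff_le_exp hn).mp h.2)
      rw [hg]; dsimp only; rw [if_pos hmem, phi, Real.rpow_neg_one]
      exact mul_le_mul_of_nonneg_right (rpow_window_le hK1 hKU hε hε4 h.1 h.2) (by positivity)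
    · rw [hg]; dsimp only
      split_ifs
      · positivity
      · exact le_rfl
  have hgs : Summable g := by
    refine summable_of_ne_finset_zero (s := Finset.Ioc M N) fun n hn => ?_
    rw [hg]; dsimp only; rw [if_neg hn]
  have hfs : Summable fun n : ℕ => (if (1 - ε) * U ≤ Real.log n ∧ Real.log n ≤ (1 + ε) * U
      then phi K (β - 1) 1 n else 0) := by
    refine Summable.of_nonneg_of_le (fun n => ?_) hle hgs
    split_ifs
    · rcases Nat.eq_zero_or_pos n with rfl | hn
      · simp [phi_zero]
      · exact phi_nonneg (by linarith) _ _ (by exact_mod_cast hn)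
    · exact le_rfl
  calc _ ≤ ∑' n, g n := Summable.tsum_le_tsum hle hfs hgs
    _ = ∑ n ∈ Finset.Ioc M N, D * ((n : ℝ))⁻¹ := by
        rw [tsum_eq_sum (s := Finset.Ioc M N) (fun n hn => by rw [hg]; dsimp only; rw [if_neg hn])]
        exact Finset.sum_congr rfl fun n hn => by rw [hg]; dsimp only; rw [if_pos hn]
    _ = D * ∑ n ∈ Finset.Ioc M N, ((n : ℝ))⁻¹ := by rw [Finset.mul_sum]
    _ ≤ D * (2 + b - a) := by gcongr; exact sum_Ioc_inv_le ha1 hab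
    _ = (3 : ℝ) ^ |β - 1| * (U ^ (β - 1) * 2 + U ^ (β - 1) * U * (2 * ε)) := by
        rw [hD, ha, hb]; ring
    _ ≤ (3 : ℝ) ^ |β - 1| * (U ^ β * ε * 2 + U ^ β * (2 * ε)) := by
        rw [show U ^ (β - 1) * U = U ^ β by rw [Real.rpow_sub_one hU.ne']; field_simp]
        gcongr
        -- U^(β-1) ≤ U^β ε  since  U ≥ 1/ε
        rw [Real.rpow_sub_one hU.ne', div_le_iff₀ hU, mul_assoc]
        refine le_mul_of_one_le_right (by positivity) ?_
        calc (1 : ℝ) = ε⁻¹ * ε := by field_simp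
          _ ≤ U * ε := by gcongr
          _ = ε * U := mul_comm _ _
    _ = _ := by ring

/-! ### (E1) the weight against `x(1-x)`, `x = n^{-1/U}` -/

/-- `y^γ e^{-y/2}` is bounded on `[0, ∞)` (`γ ≥ 0`). [folklore] -/
lemma exists_bound_rpow_mul_exp_neg_half {γ : ℝ} (hγ : 0 ≤ γ) :
    ∃ M : ℝ, 0 < M ∧ ∀ y : ℝ, 0 ≤ y → y ^ γ * Real.exp (-(y / 2)) ≤ M := by
  set k := ⌈γ⌉₊
  refine ⟨1 + 2 ^ k * k.factorial, by positivity, fun y hy => ?_⟩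
  have h1 : y ^ γ ≤ 1 + y ^ k := by
    rcases le_or_gt y 1 with hy1 | hy1
    · have := Real.rpow_le_one hy hy1 hγ
      have : 0 ≤ y ^ k := by positivity
      linarith
    · have : y ^ γ ≤ y ^ (k : ℝ) := Real.rpow_le_rpow_of_exponent_le hy1.le (Nat.le_ceil γ)
      rw [Real.rpow_natCast] at this
      linarith
  have h2 : y ^ k ≤ 2 ^ k * k.factorial * Real.exp (y / 2) := by
    have := Real.pow_div_factorial_le_exp (y / 2) (by positivity) k
    rw [div_pow, div_div, div_le_iff₀ (by positivity)] at this
    linarith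
  have he : 0 < Real.exp (-(y / 2)) := Real.exp_pos _
  have he1 : Real.exp (-(y / 2)) ≤ 1 := Real.exp_le_one_iff.mpr (by linarith)
  have hee : Real.exp (y / 2) * Real.exp (-(y / 2)) = 1 := by rw [← Real.exp_add]; simp
  calc y ^ γ * Real.exp (-(y / 2)) ≤ (1 + 2 ^ k * k.factorial * Real.exp (y / 2)) *
      Real.exp (-(y / 2)) := by gcongr; linarith
    _ = Real.exp (-(y / 2)) + 2 ^ k * k.factorial * (Real.exp (y / 2) * Real.exp (-(y / 2))) := by
        ring
    _ ≤ 1 + 2 ^ k * k.factorial := by rw [hee, mul_one]; gcongr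

/-- The tail factor: `(K + u)^{β-1} e^{-u/(2U)} ≤ C U^{β-1}` for `u ≥ U ≥ K`. [folklore] -/
lemma exists_tail_const (K β : ℝ) (hK : 0 < K) : ∃ C : ℝ, 0 < C ∧ ∀ U u : ℝ, K ≤ U → U ≤ u →
    (K + u) ^ (β - 1) * Real.exp (-(u / (2 * U))) ≤ C * U ^ (β - 1) := by
  rcases le_or_gt β 1 with hβ | hβ
  · refine ⟨1, one_pos, fun U u hKU hUu => ?_⟩
    have hU : 0 < U := by linarith
    have h1 : (K + u) ^ (β - 1) ≤ U ^ (β - 1) :=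
      Real.rpow_le_rpow_of_nonpos hU (by linarith) (by linarith)
    have h2 : Real.exp (-(u / (2 * U))) ≤ 1 := Real.exp_le_one_iff.mpr (by
      have := div_nonneg (by linarith : 0 ≤ u) (by linarith : 0 ≤ 2 * U); linarith)
    have h3 : 0 ≤ (K + u) ^ (β - 1) := Real.rpow_nonneg (by linarith) _
    nlinarith
  · obtain ⟨M, hM, hMb⟩ := exists_bound_rpow_mul_exp_neg_half (γ := β - 1) (by linarith)
    refine ⟨2 ^ (β - 1) * M, by positivity, fun U u hKU hUu => ?_⟩
    have hU : 0 < U := by linarith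
    have hu : 0 < u := by linarith
    have h1 : (K + u) ^ (β - 1) ≤ (2 * U * (u / U)) ^ (β - 1) :=
      Real.rpow_le_rpow (by linarith) (by field_simp; linarith) (by linarith)
    rw [Real.mul_rpow (by positivity) (by positivity), Real.mul_rpow (by norm_num) hU.le] at h1
    have h2 := hMb (u / U) (by positivity)
    have h3 : Real.exp (-(u / (2 * U))) = Real.exp (-(u / U / 2)) := by
      congr 1; field_simp
    rw [h3]
    calc (K + u) ^ (β - 1) * Real.exp (-(u / U / 2))
        ≤ 2 ^ (β - 1) * U ^ (β - 1) * (u / U) ^ (β - 1) * Real.exp (-(u / U / 2)) := by gcongr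
      _ = 2 ^ (β - 1) * U ^ (β - 1) * ((u / U) ^ (β - 1) * Real.exp (-(u / U / 2))) := by ring
      _ ≤ 2 ^ (β - 1) * U ^ (β - 1) * M := by gcongr
      _ = _ := by ring

/-- `Σ_{n ≥ 1} n^{-1-s} ≤ 1 + 1/s` (via `phi K 0 (1+s)`). [folklore] -/
lemma tsum_phi_zero_le {K s : ℝ} (hK : 0 < K) (hs : 0 < s) :
    ∑' n : ℕ, phi K 0 (1 + s) n ≤ 1 + 1 / s := by
  have := (phi_tsum_bounds (γ := 0) hK hK.le (show 1 < 1 + s by linarith)).2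
  rw [Real.rpow_zero] at this
  refine this.trans ?_
  have hI : ∫ t in Ioi (1 : ℝ), phi K 0 (1 + s) t = 1 / s := by
    have : ∀ t ∈ Ioi (1 : ℝ), phi K 0 (1 + s) t = t ^ (-(1 + s)) := fun t _ => by simp [phi]
    rw [setIntegral_congr_fun measurableSet_Ioi this,
      integral_Ioi_rpow_of_lt (by linarith) one_pos, Real.one_rpow,
      show -(1 + s) + 1 = -s by ring, neg_div_neg_eq]
  rw [hI]

/-- Pointwise bound behind (E1): with `u = log n`, `x = e^{-u/U}`,
`(K+u)^{β-1} n^{-1} x(1-x) ≤ (2U)^β/U · [n ≤ e^U]/n + C U^{β-1} n^{-1-1/(2U)}`. [folklore] -/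
lemma phi_mul_x_le {K β C U : ℝ} (hK1 : 1 ≤ K) (hβ : 0 ≤ β) (hKU : K ≤ U)
    (hC : ∀ u : ℝ, U ≤ u → (K + u) ^ (β - 1) * Real.exp (-(u / (2 * U))) ≤ C * U ^ (β - 1))
    {n : ℕ} (hn : 1 ≤ n) :
    phi K (β - 1) 1 n * (Real.exp (-(Real.log n / U)) * (1 - Real.exp (-(Real.log n / U)))) ≤
      (2 * U) ^ β / U * (if n ≤ ⌊Real.exp U⌋₊ then ((n : ℝ))⁻¹ else 0) +
        C * U ^ (β - 1) * phi K 0 (1 + 1 / (2 * U)) n := by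
  have hU : 0 < U := by linarith
  have hn0 : (0 : ℝ) < n := by exact_mod_cast hn
  set u := Real.log n with hu
  have hu0 : 0 ≤ u := Real.log_nonneg (by exact_mod_cast hn)
  have hKu : 0 < K + u := by linarith
  set x := Real.exp (-(u / U)) with hx
  have hx0 : 0 < x := Real.exp_pos _
  have hx1 : x ≤ 1 := Real.exp_le_one_iff.mpr (by
    have := div_nonneg hu0 hU.le; linarith)
  have hC0 : 0 ≤ C * U ^ (β - 1) := by
    have := hC U le_rfl
    exact le_trans (mul_nonneg (Real.rpow_nonneg (by linarith) _) (Real.exp_pos _).le) this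
  have hphi0 : 0 ≤ phi K 0 (1 + 1 / (2 * U)) n :=
    phi_nonneg (by linarith) _ _ (by exact_mod_cast hn)
  have hB : 0 ≤ C * U ^ (β - 1) * phi K 0 (1 + 1 / (2 * U)) n := mul_nonneg hC0 hphi0
  -- the term itself
  have hphi : phi K (β - 1) 1 n = (K + u) ^ (β - 1) * ((n : ℝ))⁻¹ := by
    rw [phi, Real.rpow_neg_one]
  rcases le_or_gt u U with huU | huU
  · -- n ≤ e^U : first bound
    have hnfl : n ≤ ⌊Real.exp U⌋₊ := Nat.le_floor ((Real.log_le_iff_le_exp hn0).mp huU)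
    rw [if_pos hnfl]
    have h1x : 1 - x ≤ u / U := by
      have := Real.add_one_le_exp (-(u / U)); rw [← hx] at this; linarith
    have hA0 : 0 ≤ (2 * U) ^ β / U * ((n : ℝ))⁻¹ := by positivity
    calc phi K (β - 1) 1 n * (x * (1 - x))
        ≤ phi K (β - 1) 1 n * (1 * (u / U)) :=
          mul_le_mul_of_nonneg_left (mul_le_mul hx1 h1x (by linarith) zero_le_one)
            (phi_nonneg (by linarith) _ _ (by exact_mod_cast hn))
      _ = (K + u) ^ (β - 1) * u / U * ((n : ℝ))⁻¹ := by rw [hphi]; ring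
      _ ≤ (K + u) ^ (β - 1) * (K + u) / U * ((n : ℝ))⁻¹ := by gcongr; linarith
      _ = (K + u) ^ β / U * ((n : ℝ))⁻¹ := by
          rw [Real.rpow_sub_one hKu.ne', div_mul_cancel₀ _ hKu.ne']
      _ ≤ (2 * U) ^ β / U * ((n : ℝ))⁻¹ := by
          gcongr
          linarith
      _ ≤ _ := le_add_of_nonneg_right hB
  · -- n > e^U : second bound
    have hA0 : 0 ≤ (2 * U) ^ β / U * (if n ≤ ⌊Real.exp U⌋₊ then ((n : ℝ))⁻¹ else 0) := by
      split_ifs <;> positivity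
    have hsplit : x = Real.exp (-(u / (2 * U))) * Real.exp (-(u / (2 * U))) := by
      rw [hx, ← Real.exp_add]; congr 1; ring
    have hphi2 : phi K 0 (1 + 1 / (2 * U)) n = ((n : ℝ))⁻¹ * Real.exp (-(u / (2 * U))) := by
      rw [phi, Real.rpow_zero, one_mul, Real.rpow_def_of_pos hn0, ← hu, ← Real.rpow_neg_one,
        Real.rpow_def_of_pos hn0, ← hu, ← Real.exp_add]
      congr 1; field_simp; ring
    calc phi K (β - 1) 1 n * (x * (1 - x))
        ≤ phi K (β - 1) 1 n * (x * 1) := by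
          gcongr
          · exact phi_nonneg (by linarith) _ _ (by exact_mod_cast hn)
          · linarith
      _ = ((K + u) ^ (β - 1) * Real.exp (-(u / (2 * U)))) *
            (((n : ℝ))⁻¹ * Real.exp (-(u / (2 * U)))) := by rw [hphi, mul_one, hsplit]; ring
      _ ≤ (C * U ^ (β - 1)) * (((n : ℝ))⁻¹ * Real.exp (-(u / (2 * U)))) :=
          mul_le_mul_of_nonneg_right (hC u huU.le) (by positivity)
      _ = C * U ^ (β - 1) * phi K 0 (1 + 1 / (2 * U)) n := by rw [hphi2]
      _ ≤ _ := le_add_of_nonneg_left hA0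

/-- (E1) `Σ_n (K + log n)^{β-1} n^{-1} x_n (1 - x_n) ≤ C₁ U^β` for large `U`, `x_n = n^{-1/U}`.
[cite: MontgomeryVaughan2007, Thm. 5.7 (proof, p. 124)] -/
lemma tsum_phi_mul_x_le {K β : ℝ} (hK1 : 1 ≤ K) (hβ : 0 ≤ β) :
    ∃ C₁ : ℝ, ∀ᶠ U : ℝ in atTop, ∑' n : ℕ, phi K (β - 1) 1 n *
      (Real.exp (-(Real.log n / U)) * (1 - Real.exp (-(Real.log n / U)))) ≤ C₁ * U ^ β := by
  obtain ⟨C, hC0, hC⟩ := exists_tail_const K β (by linarith)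
  refine ⟨2 * 2 ^ β + 3 * C, ?_⟩
  filter_upwards [eventually_ge_atTop K, eventually_ge_atTop (1 : ℝ)] with U hKU hU1
  have hU : 0 < U := by linarith
  set s := 1 / (2 * U) with hs
  have hs0 : 0 < s := by positivity
  set gA : ℕ → ℝ := fun n => (2 * U) ^ β / U * (if n ≤ ⌊Real.exp U⌋₊ then ((n : ℝ))⁻¹ else 0)
  set gB : ℕ → ℝ := fun n => C * U ^ (β - 1) * phi K 0 (1 + s) n
  set f : ℕ → ℝ := fun n => phi K (β - 1) 1 n *
      (Real.exp (-(Real.log n / U)) * (1 - Real.exp (-(Real.log n / U))))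
  have hle : ∀ n, f n ≤ gA n + gB n := by
    intro n
    rcases Nat.eq_zero_or_pos n with rfl | hn
    · simp [f, gA, gB, phi_zero K (β - 1) one_ne_zero, phi_zero K 0 (show 1 + s ≠ 0 by positivity)]
    · exact phi_mul_x_le hK1 hβ hKU (fun u hu => hC U u hKU hu) hn
  have hf0 : ∀ n, 0 ≤ f n := by
    intro n
    rcases Nat.eq_zero_or_pos n with rfl | hn
    · simp [f, phi_zero]
    · have hx0 : 0 < Real.exp (-(Real.log n / U)) := Real.exp_pos _
      have hx1 : Real.exp (-(Real.log n / U)) ≤ 1 := Real.exp_le_one_iff.mpr (by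
        have := div_nonneg (Real.log_nonneg (show (1:ℝ) ≤ n by exact_mod_cast hn)) hU.le
        linarith)
      exact mul_nonneg (phi_nonneg (by linarith) _ _ (by exact_mod_cast hn))
        (mul_nonneg hx0.le (by linarith))
  have hgAs : Summable gA := by
    refine (summable_of_ne_finset_zero (s := Finset.range (⌊Real.exp U⌋₊ + 1))
      fun n hn => ?_).mul_left _
    rw [Finset.mem_range] at hn
    rw [if_neg (by omega)]
  have hgBs : Summable gB :=
    (phi_summable (γ := 0) (by linarith) (by linarith) (by linarith)).mul_left _
  have hfs : Summable f := Summable.of_nonneg_of_le hf0 hle (hgAs.add hgBs)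
  have hA : ∑' n, gA n ≤ (2 * U) ^ β / U * (1 + U) := by
    rw [tsum_mul_left]
    refine mul_le_mul_of_nonneg_left ?_ (by positivity)
    rw [tsum_eq_sum (s := Finset.range (⌊Real.exp U⌋₊ + 1))
      (fun n hn => by rw [Finset.mem_range] at hn; rw [if_neg (by omega)])]
    have : ∑ n ∈ Finset.range (⌊Real.exp U⌋₊ + 1),
        (if n ≤ ⌊Real.exp U⌋₊ then ((n : ℝ))⁻¹ else 0) = harmonic ⌊Real.exp U⌋₊ := by
      rw [harmonic_eq_sum_Icc, Finset.range_eq_Ico]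
      push_cast
      rw [Finset.sum_eq_sum_Ico_succ_bot (by omega), Finset.Ico_add_one_right_eq_Icc]
      simp only [Nat.cast_zero, inv_zero, ite_self, zero_add]
      exact Finset.sum_congr rfl fun n hn => by
        rw [Finset.mem_Icc] at hn; rw [if_pos hn.2]
    rw [this]
    have := harmonic_floor_le_one_add_log (Real.exp U) (Real.one_le_exp_iff.mpr hU.le)
    rwa [Real.log_exp] at this
  have hB : ∑' n, gB n ≤ C * U ^ (β - 1) * (1 + 1 / s) := by
    rw [tsum_mul_left]
    exact mul_le_mul_of_nonneg_left (tsum_phi_zero_le (by linarith) hs0) (by positivity)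
  calc ∑' n, f n ≤ ∑' n, (gA n + gB n) := Summable.tsum_le_tsum hle hfs (hgAs.add hgBs)
    _ = ∑' n, gA n + ∑' n, gB n := Summable.tsum_add hgAs hgBs
    _ ≤ (2 * U) ^ β / U * (1 + U) + C * U ^ (β - 1) * (1 + 1 / s) := add_le_add hA hB
    _ = 2 ^ β * U ^ β * ((1 + U) / U) + C * (U ^ (β - 1) * U) * ((1 + 2 * U) / U) := by
        rw [Real.mul_rpow (by norm_num) hU.le, hs]; field_simp
    _ = 2 ^ β * U ^ β * ((1 + U) / U) + C * U ^ β * ((1 + 2 * U) / U) := by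
        rw [Real.rpow_sub_one hU.ne']; field_simp
    _ ≤ 2 ^ β * U ^ β * 2 + C * U ^ β * 3 := by
        gcongr
        · rw [div_le_iff₀ hU]; linarith
        · rw [div_le_iff₀ hU]; linarith
    _ = _ := by ring



/-! ### From `HardyLittlewoodTauberianSums` to Dirichlet series -/

/-- `e^{-δ log n} = n^{-δ}` for `n ≥ 1`. [folklore] -/
lemma exp_neg_mul_log_nat {n : ℕ} (hn : n ≠ 0) (δ : ℝ) :
    Real.exp (-(δ * Real.log n)) = (n : ℝ) ^ (-δ) := by
  rw [Real.rpow_def_of_pos (by positivity)]; ring_nf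

/-- `(x/n) e^{-δ log n} = x / n^{1+δ}` (all `n`, junk values agree at `n = 0`). [folklore] -/
lemma div_nat_mul_exp (x : ℝ) (n : ℕ) {δ : ℝ} (hδ : 0 < δ) :
    x / n * Real.exp (-(δ * Real.log n)) = x / (n : ℝ) ^ (1 + δ) := by
  rcases Nat.eq_zero_or_pos n with rfl | hn
  · simp [Real.zero_rpow (show (1 + δ : ℝ) ≠ 0 by linarith)]
  · have hn0 : (0 : ℝ) < n := by exact_mod_cast hn
    rw [exp_neg_mul_log_nat (by omega), Real.rpow_add hn0, Real.rpow_one, Real.rpow_neg hn0.le]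
    field_simp

/-- `φ_{γ,1}(n) e^{-δ log n} = φ_{γ,1+δ}(n)` (all `n`). [folklore] -/
lemma phi_mul_exp (K γ : ℝ) (n : ℕ) {δ : ℝ} (hδ : 0 < δ) :
    phi K γ 1 n * Real.exp (-(δ * Real.log n)) = phi K γ (1 + δ) n := by
  rcases Nat.eq_zero_or_pos n with rfl | hn
  · simp [phi_zero K γ one_ne_zero, phi_zero K γ (show (1 + δ : ℝ) ≠ 0 by linarith)]
  · have hn0 : (0 : ℝ) < n := by exact_mod_cast hn
    rw [exp_neg_mul_log_nat (by omega), phi, phi, mul_assoc, ← Real.rpow_add hn0]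
    congr 2; ring

/-- `(1 + u)^{β-1} ≤ K (K + u)^{β-1}` for `u ≥ 0`, `0 ≤ β`, `K ≥ 1`. [folklore] -/
lemma one_add_rpow_le {K β u : ℝ} (hK1 : 1 ≤ K) (hβ : 0 ≤ β) (hu : 0 ≤ u) :
    (1 + u) ^ (β - 1) ≤ K * (K + u) ^ (β - 1) := by
  rcases le_or_gt 1 β with h1 | h1
  · calc (1 + u) ^ (β - 1) ≤ (K + u) ^ (β - 1) :=
          Real.rpow_le_rpow (by linarith) (by linarith) (by linarith)
      _ ≤ K * (K + u) ^ (β - 1) := le_mul_of_one_le_left (Real.rpow_nonneg (by linarith) _) hK1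
  · set e := 1 - β with he
    have he0 : 0 < e := by linarith
    have he1 : e ≤ 1 := by linarith
    have hK0 : 0 < K := by linarith
    have h : (K + u) ^ e ≤ K * (1 + u) ^ e := by
      calc (K + u) ^ e ≤ (K * (1 + u)) ^ e := Real.rpow_le_rpow (by linarith) (by nlinarith) he0.le
        _ = K ^ e * (1 + u) ^ e := Real.mul_rpow hK0.le (by linarith)
        _ ≤ K * (1 + u) ^ e := by
            gcongr
            exact Real.rpow_le_self_of_one_le hK1 he1
    rw [show β - 1 = -e by rw [he]; ring, Real.rpow_neg (by linarith), Real.rpow_neg (by linarith)]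
    have h1u : 0 < (1 + u) ^ e := Real.rpow_pos_of_pos (by linarith) _
    have hKu : 0 < (K + u) ^ e := Real.rpow_pos_of_pos (by linarith) _
    calc ((1 + u) ^ e)⁻¹ = (K * (1 + u) ^ e)⁻¹ * K := by field_simp
      _ ≤ ((K + u) ^ e)⁻¹ * K := by gcongr
      _ = K * ((K + u) ^ e)⁻¹ := mul_comm _ _

/-- For `N ≥ 1`: `Σ_n [log n ≤ log N] c_n = Σ_{n=1}^N c_n` when `c 0 = 0`. [folklore] -/
lemma tsum_trunc_log_eq (c : ℕ → ℝ) (hc0 : c 0 = 0) {N : ℕ} (hN : 1 ≤ N) :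
    (∑' n : ℕ, if Real.log n ≤ Real.log N then c n else 0) = ∑ n ∈ Finset.Icc 1 N, c n := by
  have hN0 : (0 : ℝ) < N := by exact_mod_cast hN
  rw [tsum_eq_sum (s := Finset.range (N + 1))]
  · rw [Finset.range_eq_Ico, Finset.sum_eq_sum_Ico_succ_bot (by omega),
      Finset.Ico_add_one_right_eq_Icc]
    simp only [Nat.cast_zero, Real.log_zero, hc0, ite_self, zero_add]
    refine Finset.sum_congr rfl fun n hn => ?_
    rw [Finset.mem_Icc] at hn
    rw [if_pos (Real.log_le_log (by exact_mod_cast hn.1) (by exact_mod_cast hn.2))]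
  · intro n hn
    rw [Finset.mem_range, not_lt] at hn
    have : Real.log N < Real.log n :=
      Real.log_lt_log hN0 (by exact_mod_cast (Nat.lt_of_succ_le hn))
    rw [if_neg (not_le.mpr this)]

/-- The reduction of MV Thm. 5.11 to `HardyLittlewoodTauberianSums`, for a general main term `m`
with prescribed Abel limit `α` and log-average limit `ℓ`.
[cite: MontgomeryVaughan2007, Thm. 5.11 (proof, pp. 125–126)] -/
theorem dirichlet_of_mainTerm (a m : ℕ → ℝ) (α β A Cm ℓ : ℝ) (hβ : 0 ≤ β)
    (hS : ∀ σ : ℝ, 1 < σ → Summable fun n : ℕ => a n / (n : ℝ) ^ σ)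
    (hT : Tendsto (fun σ : ℝ => (σ - 1) ^ β * ∑' n : ℕ, a n / (n : ℝ) ^ σ) (𝓝[>] 1) (𝓝 α))
    (hTaub : ∀ n : ℕ, 1 ≤ n → -A * (1 + Real.log n) ^ (β - 1) ≤ a n)
    (hm0 : m 0 = 0)
    (hm1 : ∀ n, |m n| ≤ Cm * phi (β + 1) (β - 1) 1 n)
    (hm2 : ∀ δ : ℝ, 0 < δ → Summable fun n => m n * Real.exp (-(δ * Real.log n)))
    (hm3 : Tendsto (fun δ : ℝ => δ ^ β * ∑' n, m n * Real.exp (-(δ * Real.log n)))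
      (𝓝[>] 0) (𝓝 α))
    (hm4 : Tendsto (fun N : ℕ => (∑ n ∈ Finset.Icc 1 N, m n) / Real.log N ^ β) atTop (𝓝 ℓ)) :
    Tendsto (fun N : ℕ => (∑ n ∈ Finset.Icc 1 N, a n / n) / Real.log N ^ β) atTop (𝓝 ℓ) := by
  set K : ℝ := β + 1 with hK
  have hK1 : 1 ≤ K := by rw [hK]; linarith
  have hK0 : 0 < K := by linarith
  set v : ℕ → ℝ := fun n => phi K (β - 1) 1 n with hv
  have hv0 : ∀ n, 0 ≤ v n := by
    intro n
    rcases Nat.eq_zero_or_pos n with rfl | hn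
    · simp [hv, phi_zero K (β - 1) one_ne_zero]
    · exact phi_nonneg hK0 _ _ (by exact_mod_cast hn)
  set c : ℕ → ℝ := fun n => a n / n - m n with hc
  have hc0 : c 0 = 0 := by simp [hc, hm0]
  set W : ℝ := K * max A 0 + max Cm 0 with hW
  have hW0 : 0 ≤ W := by positivity
  set w : ℕ → ℝ := fun n => W * v n with hw
  have hlam : ∀ n : ℕ, 0 ≤ Real.log n := fun n => Real.log_natCast_nonneg n
  have hwnn : ∀ n, 0 ≤ w n := fun n => mul_nonneg hW0 (hv0 n)
  -- Tauberian condition for c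
  have hcw : ∀ n, -w n ≤ c n := by
    intro n
    rcases Nat.eq_zero_or_pos n with rfl | hn
    · simp [hc0, hwnn 0]
    · have hn0 : (0 : ℝ) < n := by exact_mod_cast hn
      have hlog : 0 ≤ Real.log n := hlam n
      have h1 : -A * (1 + Real.log n) ^ (β - 1) / n ≤ a n / n :=
        div_le_div_of_nonneg_right (hTaub n hn) hn0.le
      have h2 : -(K * max A 0 * v n) ≤ -A * (1 + Real.log n) ^ (β - 1) / n := by
        have hvn : v n = (K + Real.log n) ^ (β - 1) / n := by
          simp only [hv, phi, Real.rpow_neg_one, div_eq_mul_inv]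
        rw [hvn, neg_mul, neg_div, neg_le_neg_iff, ← mul_div_assoc]
        refine div_le_div_of_nonneg_right ?_ hn0.le
        have h3 : (1 + Real.log n) ^ (β - 1) ≤ K * (K + Real.log n) ^ (β - 1) :=
          one_add_rpow_le hK1 hβ hlog
        have h4 : 0 ≤ (1 + Real.log n) ^ (β - 1) := Real.rpow_nonneg (by linarith) _
        calc A * (1 + Real.log n) ^ (β - 1) ≤ max A 0 * (1 + Real.log n) ^ (β - 1) := by
              gcongr; exact le_max_left _ _
          _ ≤ max A 0 * (K * (K + Real.log n) ^ (β - 1)) := by gcongr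
          _ = _ := by ring
      have h3 : m n ≤ max Cm 0 * v n :=
        (le_abs_self _).trans ((hm1 n).trans (mul_le_mul_of_nonneg_right (le_max_left _ _) (hv0 n)))
      simp only [hc, hw, hW]
      nlinarith
  -- summability
  have hcs : ∀ δ : ℝ, 0 < δ → Summable fun n => c n * Real.exp (-(δ * Real.log n)) := by
    intro δ hδ
    have h1 : Summable fun n : ℕ => a n / n * Real.exp (-(δ * Real.log n)) := by
      simp_rw [div_nat_mul_exp _ _ hδ]
      exact hS _ (by linarith)
    simpa [hc, sub_mul] using h1.sub (hm2 δ hδ)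
  have hvs : ∀ δ : ℝ, 0 < δ → Summable fun n => v n * Real.exp (-(δ * Real.log n)) := by
    intro δ hδ
    simp_rw [hv, phi_mul_exp K (β - 1) _ hδ]
    exact phi_summable hK0 (by rw [hK]; linarith) (by linarith)
  have hws : ∀ δ : ℝ, 0 < δ → Summable fun n => w n * Real.exp (-(δ * Real.log n)) := by
    intro δ hδ
    simpa [hw, mul_assoc] using (hvs δ hδ).mul_left W
  -- the Abelian hypothesis for c: δ^β Σ c_n n^{-δ} → α - α = 0
  have hlim : Tendsto (fun δ : ℝ => δ ^ β * ∑' n, c n * Real.exp (-(δ * Real.log n)))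
      (𝓝[>] 0) (𝓝 0) := by
    have hshift : Tendsto (fun δ : ℝ => 1 + δ) (𝓝[>] 0) (𝓝[>] 1) := by
      refine tendsto_nhdsWithin_iff.mpr ⟨?_, ?_⟩
      · have : Tendsto (fun δ : ℝ => 1 + δ) (𝓝 0) (𝓝 (1 + 0)) := tendsto_const_nhds.add tendsto_id
        rw [add_zero] at this
        exact this.mono_left nhdsWithin_le_nhds
      · filter_upwards [self_mem_nhdsWithin] with δ hδ
        simp only [mem_Ioi] at hδ ⊢
        linarith
    have hA : Tendsto (fun δ : ℝ => δ ^ β * ∑' n : ℕ, a n / n * Real.exp (-(δ * Real.log n)))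
        (𝓝[>] 0) (𝓝 α) := by
      have := hT.comp hshift
      refine this.congr' ?_
      filter_upwards [self_mem_nhdsWithin] with δ hδ
      simp only [Function.comp_def, add_sub_cancel_left]
      congr 1
      exact tsum_congr fun n => (div_nat_mul_exp _ _ hδ).symm
    have := hA.sub hm3
    rw [sub_self] at this
    refine this.congr' ?_
    filter_upwards [self_mem_nhdsWithin] with δ hδ
    have h1 : Summable fun n : ℕ => a n / n * Real.exp (-(δ * Real.log n)) := by
      simp_rw [div_nat_mul_exp _ _ (show (0:ℝ) < δ from hδ)]
      exact hS _ (by simp only [mem_Ioi] at hδ; linarith)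
    rw [← mul_sub, ← Summable.tsum_sub h1 (hm2 δ hδ)]
    congr 1
    exact tsum_congr fun n => by simp only [hc]; ring
  -- weight estimates
  obtain ⟨C₁, hC₁⟩ := tsum_phi_mul_x_le (β := β) hK1 hβ
  set C : ℝ := max (W * C₁) (W * (4 * (3 : ℝ) ^ |β - 1|)) with hCdef
  have hE1 : ∀ᶠ U : ℝ in atTop, ∑' n : ℕ, w n * (Real.exp (-(Real.log n / U)) *
      (1 - Real.exp (-(Real.log n / U)))) ≤ C * U ^ β := by
    filter_upwards [hC₁, eventually_ge_atTop 0] with U hU hU0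
    simp only [hw, mul_assoc]
    rw [tsum_mul_left]
    calc W * _ ≤ W * (C₁ * U ^ β) := mul_le_mul_of_nonneg_left hU hW0
      _ = (W * C₁) * U ^ β := by ring
      _ ≤ C * U ^ β := mul_le_mul_of_nonneg_right (le_max_left _ _) (Real.rpow_nonneg hU0 _)
  have hE2 : ∀ ε : ℝ, 0 < ε → ε < 1 / 4 → ∀ᶠ U : ℝ in atTop,
      ∑' n : ℕ, (if (1 - ε) * U ≤ Real.log n ∧ Real.log n ≤ (1 + ε) * U then w n else 0) ≤
        C * ε * U ^ β := by
    intro ε hε hε4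
    filter_upwards [tsum_window_le (β := β) hK1 hε hε4, eventually_ge_atTop 0] with U hU hU0
    have : (fun n : ℕ => if (1 - ε) * U ≤ Real.log n ∧ Real.log n ≤ (1 + ε) * U then w n else 0) =
        fun n : ℕ => W * (if (1 - ε) * U ≤ Real.log n ∧ Real.log n ≤ (1 + ε) * U
          then v n else 0) := by
      ext n; simp only [hw]; split_ifs <;> simp
    rw [this, tsum_mul_left]
    calc W * _ ≤ W * ((4 * (3 : ℝ) ^ |β - 1|) * ε * U ^ β) := mul_le_mul_of_nonneg_left hU hW0
      _ = (W * (4 * (3 : ℝ) ^ |β - 1|)) * (ε * U ^ β) := by ring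
      _ ≤ C * (ε * U ^ β) :=
          mul_le_mul_of_nonneg_right (le_max_right _ _) (by positivity)
      _ = C * ε * U ^ β := by ring
  -- apply the abstract theorem
  have hmain := HardyLittlewoodTauberianSums_holds (fun n => Real.log n) c w β C hβ hlam hwnn hcw
    hcs hws hlim hE1 hE2
  -- specialise to U = log N
  have hlogN : Tendsto (fun N : ℕ => Real.log N) atTop atTop :=
    Real.tendsto_log_atTop.comp tendsto_natCast_atTop_atTop
  have hcN : Tendsto (fun N : ℕ => (∑ n ∈ Finset.Icc 1 N, c n) / Real.log N ^ β) atTop (𝓝 0) := by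
    refine (hmain.comp hlogN).congr' ?_
    filter_upwards [eventually_ge_atTop 1] with N hN
    simp only [Function.comp_def]
    rw [tsum_trunc_log_eq c hc0 hN]
  have := hcN.add hm4
  rw [zero_add] at this
  refine this.congr' (Eventually.of_forall fun N => ?_)
  rw [← add_div, ← Finset.sum_add_distrib]
  congr 1
  exact Finset.sum_congr rfl fun n _ => by simp only [hc]; ring

end Karamata

open Karamata in
/-- **Proof of the Hardy–Littlewood Tauberian theorem for Dirichlet series**
(Montgomery–Vaughan 2007, Thm. 5.11), by Karamata's method: `HardyLittlewoodTauberianSums_holds`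
(MV Thm. 5.7 in Stieltjes form) applied to `λ_n = log n`, `c_n = a_n/n - m_n` with the main term
`m_n = (α/Γ(β)) (β+1+log n)^{β-1}/n` (`β > 0`) resp. `m_n = α [n = 1]` (`β = 0`), whose Abel means
tend to `α` (`δ^β Σ (K+log n)^{β-1} n^{-1-δ} → Γ(β)`, integral test + `Γ`-integral) and whose
log-averages give `α/Γ(β+1)`. [cite: MontgomeryVaughan2007, Thm. 5.11] -/
theorem HardyLittlewoodTauberianDirichlet_holds : HardyLittlewoodTauberianDirichlet := by
  intro a α β A hβ hS hT hTaub
  rcases eq_or_lt_of_le hβ with hβ0 | hβpos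
  · -- β = 0: main term α at n = 1
    subst hβ0
    refine dirichlet_of_mainTerm a (fun n => if n = 1 then α else 0) α 0 A |α| _ le_rfl hS hT hTaub
      (by simp) ?_ ?_ ?_ ?_
    · intro n
      split_ifs with h
      · subst h; simp [phi_one]
      · simp only [abs_zero]
        rcases Nat.eq_zero_or_pos n with rfl | hn
        · simp [phi_zero]
        · exact mul_nonneg (abs_nonneg _) (phi_nonneg (by norm_num) _ _ (by exact_mod_cast hn))
    · intro δ _
      exact summable_of_ne_finset_zero (s := {1}) fun n hn => by
        rw [Finset.mem_singleton] at hn; simp [hn]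
    · simp only [Real.rpow_zero, one_mul]
      refine tendsto_const_nhds.congr' (Eventually.of_forall fun δ => ?_)
      dsimp only
      rw [tsum_eq_single 1 (fun n hn => by simp [hn])]
      simp
    · simp only [Real.rpow_zero, div_one, zero_add, Real.Gamma_one]
      refine tendsto_const_nhds.congr' ?_
      filter_upwards [eventually_ge_atTop 1] with N hN
      rw [Finset.sum_ite_eq' (Finset.Icc 1 N) 1 (fun _ => α), if_pos (by simp [hN])]
  · -- β > 0: main term (α/Γ(β)) (K + log n)^{β-1}/n
    have hΓ : 0 < Real.Gamma β := Real.Gamma_pos_of_pos hβpos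
    have hK0 : (0 : ℝ) < β + 1 := by linarith
    refine dirichlet_of_mainTerm a (fun n => α / Real.Gamma β * phi (β + 1) (β - 1) 1 n) α β A
      (|α| / Real.Gamma β) _ hβ hS hT hTaub (by simp [phi_zero]) ?_ ?_ ?_ ?_
    · intro n
      rw [abs_mul, abs_div, abs_of_pos hΓ]
      rcases Nat.eq_zero_or_pos n with rfl | hn
      · simp [phi_zero]
      · rw [abs_of_nonneg (phi_nonneg hK0 _ _ (by exact_mod_cast hn))]
    · intro δ hδ
      simp_rw [mul_assoc, phi_mul_exp (β + 1) (β - 1) _ hδ]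
      exact (phi_summable hK0 (by linarith) (by linarith)).mul_left _
    · have h := tendsto_rpow_mul_tsum_phi hK0 hβpos (by linarith)
      have := h.const_mul (α / Real.Gamma β)
      rw [div_mul_cancel₀ _ hΓ.ne'] at this
      refine this.congr' ?_
      filter_upwards [self_mem_nhdsWithin] with δ hδ
      simp_rw [mul_assoc, phi_mul_exp (β + 1) (β - 1) _ (show (0:ℝ) < δ from hδ)]
      rw [tsum_mul_left]; ring
    · have h := (tendsto_sum_phi_div hK0 hβpos (by linarith)).const_mul (α / Real.Gamma β)
      have hval : α / Real.Gamma β * (1 / β) = α / Real.Gamma (β + 1) := by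
        rw [Real.Gamma_add_one hβpos.ne']; field_simp
      rw [hval] at h
      refine h.congr' (Eventually.of_forall fun N => ?_)
      dsimp only
      rw [← Finset.mul_sum, mul_div_assoc]

/-- The little-`o` phrasing `Literature.NumberTheory.LFunctions.MontgomeryVaughan2007_5_11` of the same theorem
(`Tauberian.lean`) follows from `HardyLittlewoodTauberianDirichlet_holds`.
[cite: MontgomeryVaughan2007, Thm. 5.11] -/
theorem MontgomeryVaughan2007_5_11_holds :
    LFunctions.MontgomeryVaughan2007_5_11 := by
  intro a β α hβ hS hT hA
  obtain ⟨A, -, hTaub⟩ := hA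
  have h := HardyLittlewoodTauberianDirichlet_holds a α β A hβ hS hT hTaub
  have hlog : Tendsto (fun N : ℕ => Real.log N) atTop atTop :=
    Real.tendsto_log_atTop.comp tendsto_natCast_atTop_atTop
  have hpos : ∀ᶠ N : ℕ in atTop, 0 < Real.log N ^ β := by
    filter_upwards [hlog.eventually_gt_atTop 0] with N hN using Real.rpow_pos_of_pos hN β
  refine (Asymptotics.isLittleO_iff_tendsto' ?_).mpr ?_
  · filter_upwards [hpos] with N hN h0 using absurd h0 hN.ne'
  · have := h.sub_const (α / Real.Gamma (β + 1))
    rw [sub_self] at this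
    refine this.congr' ?_
    filter_upwards [hpos] with N hN
    rw [sub_div, mul_div_assoc, div_self hN.ne', mul_one]

end Literature.NumberTheory.LFunctions
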